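import Literature.Computability.Complexity.KarpProblems
import Mathlib.Algebra.BigOperators.Fin
import Mathlib.Algebra.Order.BigOperators.Group.Finset
import Mathlib.Tactic.IntervalCases
import HarnessLib

/-!
# 4-PARTITION instances of 3-DIMENSIONAL MATCHING (Garey–Johnson 1979, Thm. 4.3)

[GareyJohnson1979, Thm. 4.3]: "4-PARTITION is NP-complete in the strong sense", by a transformation
from 3DM. Given `M ⊆ W × X × Y` (`|W| = |X| = |Y| = q`), "our corresponding instance of 4-PARTITION
has `|A| = 4|M|` elements, one for each occurrence of a member of `W ∪ X ∪ Y` in a triple in `M` and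
one for each triple in `M`"; with `r = 32q`: `s(w_i[1]) = 10r⁴ + ir + 1`, `s(w_i[l]) = 11r⁴ + ir + 1`
(`l ≥ 2`), `s(x_j[1]) = 10r⁴ + jr² + 2`, `s(x_j[l]) = 11r⁴ + jr² + 2`, `s(y_k[1]) = 10r⁴ + kr³ + 4`,
`s(y_k[l]) = 8r⁴ + kr³ + 4`, `s(u_l) = 10r⁴ − kr³ − jr² − ir + 8`, `B = 40r⁴ + 15`; each size is
strictly between `B/5` and `B/3`, and "the desired 4-partition exists if and only if `M` contains a
matching".

This file formalises the instance for a LIST of triples `T` over `Fin q` (indices `0 … q−1`, which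
changes nothing in the argument; the "actual" element of `z` is the one at its first occurrence in
`T`) and proves the equivalence, under the hypothesis — implicit in the printed proof ("the total
collection of `3q` actual elements, one for each member of `W ∪ X ∪ Y`") — that every member of
`W ∪ X ∪ Y` occurs in some triple:

* `GJ4P.size T : Fin |T| × Fin 4 → ℕ` (kinds `u, w, x, y`), `GJ4P.bigB q`, the bounds
  `GJ4P.bigB_lt_five_mul_size`, `GJ4P.three_mul_size_lt_bigB`;
* `GJ4P.partition_of_matching` (a matching yields an assignment with all sums `B`: swap the actual
  slot into the matched triple);
* `GJ4P.matching_of_partition` (sums `B` force, fibre by fibre, one element of each kind — residues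
  `8, 1, 2, 4` modulo `r` — with the coordinates of the `u`-element — base-`r` digits — all actual or
  all dummy; the all-actual fibres give the matching);
* `GJ4P.matching_iff_partition`, and the list form `GJ4P.sizes` used by the machine.

Everything here is proved; no named facts.

## References

* [GareyJohnson1979] M. R. Garey, D. S. Johnson, *Computers and Intractability*, Freeman 1979,
  §4.2.2, Thm. 4.3, pp. 97–99.
-/

namespace Literature.Computability.Complexity

namespace GJ4P

open Finset

/-! ### Arithmetic core -/

/-- **Base-`r` digits**: `a₄ r³ + a₃ r² + a₂ r + a₁ = 0` with `|a₁|, |a₂|, |a₃| < r` forces all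
`aₑ = 0`. [cite: GareyJohnson1979, Thm. 4.3 (proof: "considering the sum modulo r, r², r³, r⁴")] -/
theorem digits_eq_zero {r : ℤ} (hr : 0 < r) {a₁ a₂ a₃ a₄ : ℤ} (h₁ : |a₁| < r) (h₂ : |a₂| < r) (h₃ : |a₃| < r)
    (h : a₄ * r ^ 3 + a₃ * r ^ 2 + a₂ * r + a₁ = 0) : a₁ = 0 ∧ a₂ = 0 ∧ a₃ = 0 ∧ a₄ = 0 := by
  -- a multiple of `r` of absolute value `< r` vanishes
  have key : ∀ {a m : ℤ}, |a| < r → a = r * m → a = 0 := by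
    intro a m ha ham
    subst ham
    rw [abs_mul, abs_of_pos hr] at ha
    have : |m| < 1 := by
      by_contra hm
      push Not at hm
      have := mul_le_mul_of_nonneg_left hm hr.le
      rw [mul_one] at this
      exact absurd (lt_of_le_of_lt this ha) (lt_irrefl _)
    rw [Int.abs_lt_one_iff] at this
    rw [this, mul_zero]
  have e1 : a₁ = r * (-(a₄ * r ^ 2 + a₃ * r + a₂)) := by linear_combination h
  have z1 : a₁ = 0 := key h₁ e1
  subst z1
  have e2 : a₂ = r * (-(a₄ * r + a₃)) := by
    have : r * (a₄ * r ^ 2 + a₃ * r + a₂) = 0 := by linear_combination h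
    rcases mul_eq_zero.1 this with h0 | h0
    · exact absurd h0 hr.ne'
    · linear_combination h0
  have z2 : a₂ = 0 := key h₂ e2
  subst z2
  have e3 : a₃ = r * (-a₄) := by
    have : r * (r * (a₄ * r + a₃)) = 0 := by linear_combination h
    rcases mul_eq_zero.1 this with h0 | h0
    · exact absurd h0 hr.ne'
    rcases mul_eq_zero.1 h0 with h0 | h0
    · exact absurd h0 hr.ne'
    · linear_combination h0
  have z3 : a₃ = 0 := key h₃ e3
  subst z3
  refine ⟨rfl, rfl, rfl, ?_⟩
  have : a₄ * r ^ 3 = 0 := by linear_combination h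
  rcases mul_eq_zero.1 this with h0 | h0
  · exact h0
  · exact absurd (pow_eq_zero_iff (by norm_num) |>.1 h0) hr.ne'

/-- The residue of kind `κ`: `u ↦ 8`, `w ↦ 1`, `x ↦ 2`, `y ↦ 4`. [cite: GareyJohnson1979, Thm. 4.3] -/
def resid (κ : Fin 4) : ℕ := if κ = 0 then 8 else if κ = 1 then 1 else if κ = 2 then 2 else 4

/-- **Residues**: four kinds (with multiplicities `n_κ`, `Σ n_κ = 4`) whose residues sum to `15`
are one of each kind. [cite: GareyJohnson1979, Thm. 4.3 (proof: "the only way these can sum to 15")] -/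
theorem counts_eq_one (n₀ n₁ n₂ n₃ : ℕ) (hsum : n₀ + n₁ + n₂ + n₃ = 4) (hres : 8 * n₀ + n₁ + 2 * n₂ + 4 * n₃ = 15) :
    n₀ = 1 ∧ n₁ = 1 ∧ n₂ = 1 ∧ n₃ = 1 := by
  omega

/-- **Coefficients**: actual/dummy patterns `(10|11) + (10|11) + (10|8) = 30` are all-actual or
all-dummy. [cite: GareyJohnson1979, Thm. 4.3 (proof: "the only way for them to sum to 40")] -/
theorem coeffs_cases {c₁ c₂ c₃ : ℕ} (h₁ : c₁ = 10 ∨ c₁ = 11) (h₂ : c₂ = 10 ∨ c₂ = 11) (h₃ : c₃ = 10 ∨ c₃ = 8)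
    (h : c₁ + c₂ + c₃ = 30) : (c₁ = 10 ∧ c₂ = 10 ∧ c₃ = 10) ∨ (c₁ = 11 ∧ c₂ = 11 ∧ c₃ = 8) := by
  omega

/-! ### The instance -/

section Instance

variable {q : ℕ} (T : List (Fin q × Fin q × Fin q))

/-- `r = 32 q`. [cite: GareyJohnson1979, Thm. 4.3] -/
def rr (q : ℕ) : ℕ := 32 * q

/-- `B = 40 r⁴ + 15`. [cite: GareyJohnson1979, Thm. 4.3] -/
def bigB (q : ℕ) : ℕ := 40 * rr q ^ 4 + 15

/-- Coordinate `c` (`0, 1, 2` for `W, X, Y`) of a triple, as a number. [folklore] -/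
def coord (t : Fin q × Fin q × Fin q) (c : Fin 3) : ℕ := if c = 0 then t.1 else if c = 1 then t.2.1 else t.2.2

/-- Coordinates are `< q`. [folklore] -/
theorem coord_lt (t : Fin q × Fin q × Fin q) (c : Fin 3) : coord t c < q := by
  unfold coord; split_ifs <;> exact Fin.isLt _

/-- Slot `l` is the FIRST occurrence of its `c`-coordinate ("actual" element; later ones are
"dummy"). [cite: GareyJohnson1979, Thm. 4.3] -/
def First (l : Fin T.length) (c : Fin 3) : Prop := ∀ l' : Fin T.length, l' < l → coord T[l'] c ≠ coord T[l] c

/-- `First` is decidable. [folklore] -/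
instance (l : Fin T.length) (c : Fin 3) : Decidable (First T l c) := by unfold First; infer_instance

/-- The `r⁴`-coefficient of the occurrence element of kind `c` at slot `l`: `10` if actual, else
`11, 11, 8` for `W, X, Y`. [cite: GareyJohnson1979, Thm. 4.3] -/
def coef (l : Fin T.length) (c : Fin 3) : ℕ := if First T l c then 10 else if c = 2 then 8 else 11

/-- The lower-order part `i r`, `j r²`, `k r³` of the occurrence element of kind `c`. [cite: GareyJohnson1979, Thm. 4.3] -/
def low (t : Fin q × Fin q × Fin q) (c : Fin 3) : ℕ := coord t c * rr q ^ (c.val + 1)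

/-- The kind `w, x, y` (`0, 1, 2`) of an occurrence slot `κ = 1, 2, 3`. [folklore] -/
def kind (κ : Fin 4) : Fin 3 := ⟨κ.val - 1, by omega⟩

/-- **The sizes** of the `4|T|` elements: slot `(l, 0)` is `u_l = 10r⁴ − kr³ − jr² − ir + 8`, slot
`(l, κ)` (`κ = 1, 2, 3`) is the occurrence of the `w, x, y`-coordinate of the `l`-th triple.
[cite: GareyJohnson1979, Thm. 4.3] -/
def size (s : Fin T.length × Fin 4) : ℕ :=
  if s.2 = 0 then 10 * rr q ^ 4 - (low T[s.1] 0 + low T[s.1] 1 + low T[s.1] 2) + 8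
  else coef T s.1 (kind s.2) * rr q ^ 4 + low T[s.1] (kind s.2) + resid s.2

/-- With a triple around, `q ≥ 1` and `r ≥ 32`. [folklore] -/
theorem rr_ge (t : Fin q × Fin q × Fin q) : 32 ≤ rr q := by
  have := t.1.pos; unfold rr; omega

/-- The `u`-quotient part is small: `i + j r + k r² < r³`. [folklore] -/
theorem uq_lt (t : Fin q × Fin q × Fin q) : 8 * (coord t 0 + coord t 1 * rr q + coord t 2 * rr q ^ 2) < rr q ^ 3 := by
  have hr := rr_ge t
  have h0 := coord_lt t 0
  have h1 := coord_lt t 1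
  have h2 := coord_lt t 2
  have hr2 : rr q ≤ rr q ^ 2 := by rw [pow_two]; exact Nat.le_mul_of_pos_left _ (by omega)
  have e0 : coord t 0 ≤ (q - 1) * rr q ^ 2 := by
    calc coord t 0 ≤ (q - 1) * 1 := by omega
      _ ≤ (q - 1) * rr q ^ 2 := Nat.mul_le_mul_left _ (by nlinarith)
  have e1 : coord t 1 * rr q ≤ (q - 1) * rr q ^ 2 :=
    (Nat.mul_le_mul_right _ (by omega : coord t 1 ≤ q - 1)).trans (Nat.mul_le_mul_left _ hr2)
  have e2 : coord t 2 * rr q ^ 2 ≤ (q - 1) * rr q ^ 2 := Nat.mul_le_mul_right _ (by omega)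
  have h3 : rr q ^ 3 = 32 * q * rr q ^ 2 := by unfold rr; ring
  rw [h3]
  have hq1 : 1 ≤ q := by unfold rr at hr; omega
  have : 8 * (3 * ((q - 1) * rr q ^ 2)) < 32 * q * rr q ^ 2 := by
    obtain ⟨q', rfl⟩ : ∃ q', q = q' + 1 := ⟨q - 1, by omega⟩
    have hpos : 0 < rr (q' + 1) ^ 2 := by positivity
    simp only [Nat.add_sub_cancel]
    nlinarith
  omega

/-- The low parts in terms of the `u`-quotient. [folklore] -/
theorem low_sum_eq (t : Fin q × Fin q × Fin q) :
    low t 0 + low t 1 + low t 2 = rr q * (coord t 0 + coord t 1 * rr q + coord t 2 * rr q ^ 2) := by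
  simp only [low, Fin.val_zero, Fin.val_one, Fin.val_two]
  ring

/-- Every size as `r · quotient + residue` with the residue of its kind. [cite: GareyJohnson1979, Thm. 4.3] -/
def quo (s : Fin T.length × Fin 4) : ℕ :=
  if s.2 = 0 then 10 * rr q ^ 3 - (coord T[s.1] 0 + coord T[s.1] 1 * rr q + coord T[s.1] 2 * rr q ^ 2)
  else coef T s.1 (kind s.2) * rr q ^ 3 + coord T[s.1] (kind s.2) * rr q ^ (kind s.2).val

/-- `size = r · quo + resid`. [cite: GareyJohnson1979, Thm. 4.3] -/
theorem size_eq (s : Fin T.length × Fin 4) : size T s = rr q * quo T s + resid s.2 := by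
  obtain ⟨l, κ⟩ := s
  unfold size quo
  by_cases h0 : κ = 0
  · subst h0
    simp only [if_true, low_sum_eq, Nat.mul_sub, resid]
    congr 1
    congr 1
    ring
  · simp only [h0, if_false, low]
    ring

/-- `quo` of a `u`-slot does not underflow. [folklore] -/
theorem quo_u (l : Fin T.length) :
    (quo T (l, 0) : ℤ) = 10 * (rr q : ℤ) ^ 3 - (coord T[l] 0 + coord T[l] 1 * rr q + coord T[l] 2 * (rr q : ℤ) ^ 2) := by
  have h := uq_lt T[l]
  have hle : coord T[l] 0 + coord T[l] 1 * rr q + coord T[l] 2 * rr q ^ 2 ≤ 10 * rr q ^ 3 := by omega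
  unfold quo
  simp only [if_true]
  rw [Nat.cast_sub hle]
  push_cast
  ring

/-- The low part of one coordinate is below `r⁴ / 8`. [folklore] -/
theorem low_lt (t : Fin q × Fin q × Fin q) (c : Fin 3) : 8 * low t c < rr q ^ 4 := by
  have h := uq_lt t
  have e := low_sum_eq t
  have hr := rr_ge t
  have hc : low t c ≤ low t 0 + low t 1 + low t 2 := by
    obtain rfl | rfl | rfl : c = 0 ∨ c = 1 ∨ c = 2 := by omega
    · omega
    · omega
    · omega
  calc 8 * low t c ≤ 8 * (low t 0 + low t 1 + low t 2) := Nat.mul_le_mul_left _ hc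
    _ = rr q * (8 * (coord t 0 + coord t 1 * rr q + coord t 2 * rr q ^ 2)) := by rw [e]; ring
    _ < rr q * rr q ^ 3 := (Nat.mul_lt_mul_left (by omega)).2 h
    _ = rr q ^ 4 := by ring

/-- The low parts together are below `r⁴ / 8`. [folklore] -/
theorem low_sum_lt (t : Fin q × Fin q × Fin q) : 8 * (low t 0 + low t 1 + low t 2) < rr q ^ 4 := by
  have h := uq_lt t
  have hr := rr_ge t
  calc 8 * (low t 0 + low t 1 + low t 2) = rr q * (8 * (coord t 0 + coord t 1 * rr q + coord t 2 * rr q ^ 2)) := by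
        rw [low_sum_eq]; ring
    _ < rr q * rr q ^ 3 := (Nat.mul_lt_mul_left (by omega)).2 h
    _ = rr q ^ 4 := by ring

/-- `coef ∈ {8, 10, 11}`, and `8` only for kind `y`. [folklore] -/
theorem coef_cases (l : Fin T.length) (c : Fin 3) : coef T l c = 10 ∨ (coef T l c = 11 ∧ c ≠ 2) ∨ (coef T l c = 8 ∧ c = 2) := by
  unfold coef; split_ifs <;> simp_all

/-- **The sizes lie strictly between `B/5` and `B/3`.** [cite: GareyJohnson1979, Thm. 4.3] -/
theorem bounds (s : Fin T.length × Fin 4) : bigB q < 5 * size T s ∧ 3 * size T s < bigB q := by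
  obtain ⟨l, κ⟩ := s
  have hr := rr_ge T[l]
  have hlow := low_sum_lt T[l]
  have hj : rr q ≤ rr q ^ 4 := Nat.le_self_pow (by norm_num) _
  unfold size bigB
  by_cases h0 : κ = 0
  · subst h0
    simp only [if_true]
    constructor <;> omega
  · simp only [h0, if_false]
    have hl := low_lt T[l] (kind κ)
    have hres1 : 1 ≤ resid κ := by unfold resid; split_ifs <;> omega
    have hres4 : resid κ ≤ 4 := by unfold resid; split_ifs <;> omega
    rcases coef_cases T l (kind κ) with hc | ⟨hc, hk⟩ | ⟨hc, hk⟩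
    · rw [hc]; constructor <;> omega
    · rw [hc]; constructor <;> omega
    · have h4 : resid κ = 4 := by
        have hκ : κ = 3 := by
          apply Fin.ext
          have := congrArg Fin.val hk
          simp only [kind] at this
          have := κ.isLt
          omega
        subst hκ; rfl
      rw [hc, h4]; constructor <;> omega

end Instance



/-! ### First occurrences and classes -/

section Classes

variable {q : ℕ} (T : List (Fin q × Fin q × Fin q))

/-- `coord` determines the component. [folklore] -/
theorem coord_eq_coord_iff (s t : Fin q × Fin q × Fin q) (c : Fin 3) :
    coord s c = coord t c ↔ (c = 0 ∧ s.1 = t.1) ∨ (c = 1 ∧ s.2.1 = t.2.1) ∨ (c = 2 ∧ s.2.2 = t.2.2) := by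
  obtain rfl | rfl | rfl : c = 0 ∨ c = 1 ∨ c = 2 := by omega
  · simp [coord, Fin.val_inj]
  · simp [coord, Fin.val_inj]
  · simp [coord, Fin.val_inj]

/-- The first slot with the same `c`-coordinate as slot `l`. [cite: GareyJohnson1979, Thm. 4.3 ("z[1]")] -/
noncomputable def lminOf (l : Fin T.length) (c : Fin 3) : Fin T.length :=
  ⟨Nat.find (p := fun n => ∃ h : n < T.length, coord T[n] c = coord T[l] c) ⟨l.val, l.isLt, rfl⟩,
    by obtain ⟨h, -⟩ := Nat.find_spec (p := fun n => ∃ h : n < T.length, coord T[n] c = coord T[l] c) ⟨l.val, l.isLt, rfl⟩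
       exact h⟩

/-- `lminOf` has the same coordinate. [folklore] -/
theorem coord_lminOf (l : Fin T.length) (c : Fin 3) : coord T[lminOf T l c] c = coord T[l] c := by
  obtain ⟨h, e⟩ := Nat.find_spec (p := fun n => ∃ h : n < T.length, coord T[n] c = coord T[l] c) ⟨l.val, l.isLt, rfl⟩
  exact e

/-- `lminOf ≤ l`. [folklore] -/
theorem lminOf_le (l : Fin T.length) (c : Fin 3) : lminOf T l c ≤ l :=
  Fin.le_def.2 (Nat.find_min' _ ⟨l.isLt, rfl⟩)

/-- `lminOf` is minimal in its class. [folklore] -/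
theorem lminOf_le_of_coord_eq {l l' : Fin T.length} (c : Fin 3) (h : coord T[l'] c = coord T[l] c) : lminOf T l c ≤ l' :=
  Fin.le_def.2 (Nat.find_min' _ ⟨l'.isLt, h⟩)

/-- `lminOf` is constant on classes. [folklore] -/
theorem lminOf_eq_of_coord_eq {l l' : Fin T.length} (c : Fin 3) (h : coord T[l'] c = coord T[l] c) :
    lminOf T l' c = lminOf T l c := by
  apply le_antisymm
  · exact lminOf_le_of_coord_eq T c ((coord_lminOf T l c).trans h.symm)
  · exact lminOf_le_of_coord_eq T c ((coord_lminOf T l' c).trans h)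

/-- **`First` is "being the minimum of one's class".** [folklore] -/
theorem first_iff (l : Fin T.length) (c : Fin 3) : First T l c ↔ lminOf T l c = l := by
  constructor
  · intro hf
    apply le_antisymm (lminOf_le T l c)
    by_contra hlt
    push Not at hlt
    exact hf _ hlt (coord_lminOf T l c)
  · intro he l' hlt hc
    have := lminOf_le_of_coord_eq T c hc
    rw [he] at this
    exact absurd hlt (not_lt.2 this)

/-- `lminOf` is a first occurrence. [folklore] -/
theorem first_lminOf (l : Fin T.length) (c : Fin 3) : First T (lminOf T l c) c := by
  rw [first_iff, lminOf_eq_of_coord_eq T c (coord_lminOf T l c)]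

end Classes

/-! ### A matching gives a 4-partition -/

section Forward

variable {q : ℕ} {T : List (Fin q × Fin q × Fin q)} {W : Finset (Fin q × Fin q × Fin q)}

/-- In a matching, equal `c`-coordinates mean equal triples. [folklore] -/
theorem eq_of_coord_eq (hm : IsThreeDMatching W) {s t : Fin q × Fin q × Fin q} (hs : s ∈ W) (ht : t ∈ W) (c : Fin 3)
    (h : coord s c = coord t c) : s = t := by
  by_contra hne
  obtain ⟨h1, h2, h3⟩ := hm hs ht hne
  rcases (coord_eq_coord_iff s t c).1 h with ⟨-, e⟩ | ⟨-, e⟩ | ⟨-, e⟩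
  · exact h1 e
  · exact h2 e
  · exact h3 e

/-- **A perfect matching hits every coordinate value exactly once.** [cite: GareyJohnson1979, Thm. 4.3] -/
theorem exists_coord_eq (hcard : W.card = q) (hm : IsThreeDMatching W) (c : Fin 3) {z : ℕ} (hz : z < q) :
    ∃ t ∈ W, coord t c = z := by
  classical
  have himg : W.image (fun t => coord t c) = Finset.range q := by
    apply Finset.eq_of_subset_of_card_le
    · exact Finset.image_subset_iff.2 fun t _ => Finset.mem_range.2 (coord_lt t c)
    · rw [Finset.card_range, Finset.card_image_of_injOn fun s hs t ht h => eq_of_coord_eq hm hs ht c h, hcard]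
  have : z ∈ W.image (fun t => coord t c) := by rw [himg]; exact Finset.mem_range.2 hz
  simpa using this

variable (hT : T.Nodup) (hW : W ⊆ T.toFinset) (hcard : W.card = q) (hm : IsThreeDMatching W)
include hW hcard hm

/-- The slot of the matched triple with the same `c`-coordinate as slot `l`. [cite: GareyJohnson1979, Thm. 4.3] -/
noncomputable def lstarOf (l : Fin T.length) (c : Fin 3) : Fin T.length :=
  ⟨T.idxOf (Classical.choose (exists_coord_eq hcard hm c (coord_lt T[l] c))),
    List.idxOf_lt_length_of_mem (List.mem_toFinset.1 (hW (Classical.choose_spec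
      (exists_coord_eq hcard hm c (coord_lt T[l] c))).1))⟩

/-- The matched triple at `lstarOf`. [folklore] -/
theorem getElem_lstarOf (l : Fin T.length) (c : Fin 3) :
    T[(lstarOf hW hcard hm l c).val] = Classical.choose (exists_coord_eq hcard hm c (coord_lt T[l] c)) :=
  List.getElem_idxOf _

/-- `lstarOf` is matched. [folklore] -/
theorem mem_lstarOf (l : Fin T.length) (c : Fin 3) : T[(lstarOf hW hcard hm l c).val] ∈ W := by
  rw [getElem_lstarOf]
  exact (Classical.choose_spec (exists_coord_eq hcard hm c (coord_lt T[l] c))).1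

/-- `lstarOf` has the same coordinate. [folklore] -/
theorem coord_lstarOf (l : Fin T.length) (c : Fin 3) : coord T[(lstarOf hW hcard hm l c).val] c = coord T[l] c := by
  rw [getElem_lstarOf]
  exact (Classical.choose_spec (exists_coord_eq hcard hm c (coord_lt T[l] c))).2

/-- `lstarOf` is constant on classes. [folklore] -/
theorem lstarOf_eq_of_coord_eq {l l' : Fin T.length} (c : Fin 3) (h : coord T[l'] c = coord T[l] c) :
    lstarOf hW hcard hm l' c = lstarOf hW hcard hm l c := by
  apply Fin.ext
  simp only [lstarOf]
  congr 1
  apply eq_of_coord_eq hm (Classical.choose_spec (exists_coord_eq hcard hm c (coord_lt T[l'] c))).1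
    (Classical.choose_spec (exists_coord_eq hcard hm c (coord_lt T[l] c))).1 c
  rw [(Classical.choose_spec (exists_coord_eq hcard hm c (coord_lt T[l'] c))).2,
    (Classical.choose_spec (exists_coord_eq hcard hm c (coord_lt T[l] c))).2, h]

include hT in
/-- A matched slot is its own `lstarOf`. [folklore] -/
theorem lstarOf_eq_self_iff (l : Fin T.length) (c : Fin 3) : lstarOf hW hcard hm l c = l ↔ T[l.val] ∈ W := by
  constructor
  · intro h
    have := mem_lstarOf hW hcard hm l c
    simp only [h] at this
    exact this
  · intro hl
    have e : Classical.choose (exists_coord_eq hcard hm c (coord_lt T[l] c)) = T[l.val] :=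
      eq_of_coord_eq hm (Classical.choose_spec (exists_coord_eq hcard hm c (coord_lt T[l] c))).1 hl c
        (Classical.choose_spec (exists_coord_eq hcard hm c (coord_lt T[l] c))).2
    apply Fin.ext
    simp only [lstarOf, e]
    exact hT.idxOf_getElem l.val l.isLt

/-- The assignment of occurrence slots: swap the actual slot of the class into the matched
triple ("if `m_l ∈ M'`, we group `u_l` with `w_i[1], x_j[1], y_k[1]`; if `m_l ∈ M − M'`, with dummy
elements"). [cite: GareyJohnson1979, Thm. 4.3] -/
noncomputable def sw (l : Fin T.length) (c : Fin 3) : Fin T.length :=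
  if l = lminOf T l c then lstarOf hW hcard hm l c
  else if l = lstarOf hW hcard hm l c then lminOf T l c else l

/-- `sw` preserves the class. [folklore] -/
theorem coord_sw (l : Fin T.length) (c : Fin 3) : coord T[(sw hW hcard hm l c).val] c = coord T[l] c := by
  unfold sw
  split_ifs
  · exact coord_lstarOf hW hcard hm l c
  · exact coord_lminOf T l c
  · rfl

/-- On a class, `sw` is the transposition of the first and the matched slot. [folklore] -/
theorem sw_eq_swap {l x : Fin T.length} (c : Fin 3) (hx : coord T[x] c = coord T[l] c) :
    sw hW hcard hm x c = Equiv.swap (lminOf T l c) (lstarOf hW hcard hm l c) x := by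
  unfold sw
  rw [lminOf_eq_of_coord_eq T c hx, lstarOf_eq_of_coord_eq hW hcard hm c hx, Equiv.swap_apply_def]

/-- `sw` is an involution. [folklore] -/
theorem sw_sw (l : Fin T.length) (c : Fin 3) : sw hW hcard hm (sw hW hcard hm l c) c = l := by
  rw [sw_eq_swap hW hcard hm c (coord_sw hW hcard hm l c), sw_eq_swap hW hcard hm c rfl, Equiv.swap_apply_self]

/-- `sw l` is the first slot of the class exactly when `l` is the matched slot. [folklore] -/
theorem sw_eq_lminOf_iff (l : Fin T.length) (c : Fin 3) :
    sw hW hcard hm l c = lminOf T l c ↔ l = lstarOf hW hcard hm l c := by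
  rw [sw_eq_swap hW hcard hm c rfl, Equiv.swap_apply_eq_iff, Equiv.swap_apply_left]

include hT in
/-- **The swapped slot is actual iff the triple is matched.** [cite: GareyJohnson1979, Thm. 4.3] -/
theorem first_sw_iff (l : Fin T.length) (c : Fin 3) : First T (sw hW hcard hm l c) c ↔ T[l.val] ∈ W := by
  rw [first_iff, lminOf_eq_of_coord_eq T c (coord_sw hW hcard hm l c), eq_comm, sw_eq_lminOf_iff, eq_comm,
    lstarOf_eq_self_iff hT hW hcard hm]

/-- **The assignment** of the `4|T|` elements to the `|T|` groups. [cite: GareyJohnson1979, Thm. 4.3] -/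
noncomputable def assign (s : Fin T.length × Fin 4) : Fin T.length :=
  if s.2 = 0 then s.1 else sw hW hcard hm s.1 (kind s.2)

include hT in
/-- **Claim**: every group of the assignment sums to `B`. [cite: GareyJohnson1979, Thm. 4.3] -/
theorem sum_assign (j : Fin T.length) :
    (∑ s : Fin T.length × Fin 4, if assign hW hcard hm s = j then size T s else 0) = bigB q := by
  classical
  rw [Fintype.sum_prod_type, Finset.sum_comm]
  -- the fibre has one slot of each kind
  have hκ : ∀ κ : Fin 4, (∑ l : Fin T.length, if assign hW hcard hm (l, κ) = j then size T (l, κ) else 0) =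
      if κ = 0 then size T (j, 0) else size T (sw hW hcard hm j (kind κ), κ) := by
    intro κ
    by_cases h0 : κ = 0
    · subst h0
      simp only [assign, if_true]
      rw [Finset.sum_ite_eq']
      simp
    · simp only [assign, h0, if_false]
      have : ∀ l : Fin T.length, (sw hW hcard hm l (kind κ) = j) ↔ (l = sw hW hcard hm j (kind κ)) := fun l =>
        ⟨fun h => by rw [← h, sw_sw], fun h => by rw [h, sw_sw]⟩
      simp only [this]
      rw [Finset.sum_ite_eq']
      simp
  simp only [hκ]
  rw [Fin.sum_univ_four]
  simp only [Fin.isValue, if_true, Fin.one_eq_zero_iff, OfNat.ofNat_ne_one, if_false, Fin.reduceEq]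
  -- arithmetic: coordinates of the swapped slots agree with those of `u_j`
  have hc : ∀ κ : Fin 4, κ ≠ 0 → low T[(sw hW hcard hm j (kind κ)).val] (kind κ) = low T[j.val] (kind κ) := by
    intro κ _
    simp only [low, coord_sw, Fin.getElem_fin]
  have hfirst : ∀ κ : Fin 4, κ ≠ 0 → (First T (sw hW hcard hm j (kind κ)) (kind κ) ↔ T[j.val] ∈ W) := fun κ _ =>
    first_sw_iff hT hW hcard hm j (kind κ)
  have hls := low_sum_lt T[j]
  simp only [size, Fin.isValue, if_true, one_ne_zero, if_false, Fin.reduceEq, coef, Fin.getElem_fin]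
  simp only [Fin.getElem_fin] at hc hls
  rw [hc 1 one_ne_zero, hc 2 (by decide), hc 3 (by decide)]
  simp only [hfirst 1 one_ne_zero, hfirst 2 (by decide), hfirst 3 (by decide)]
  have k1 : kind 1 = 0 := rfl
  have k2 : kind 2 = 1 := rfl
  have k3 : kind 3 = 2 := rfl
  have r1 : resid 1 = 1 := rfl
  have r2 : resid 2 = 2 := rfl
  have r3 : resid 3 = 4 := rfl
  simp only [k1, k2, k3, r1, r2, r3, bigB]
  by_cases hj : T[j.val] ∈ W
  · simp only [hj, if_true]
    omega
  · simp only [hj, if_false, Fin.isValue, Fin.reduceEq, if_true]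
    omega

include hT in
/-- **A matching yields a 4-partition.** [cite: GareyJohnson1979, Thm. 4.3 (proof, first direction)] -/
theorem partition_of_matching :
    ∃ g : Fin T.length × Fin 4 → Fin T.length, ∀ j, (∑ s, if g s = j then size T s else 0) = bigB q :=
  ⟨assign hW hcard hm, sum_assign hT hW hcard hm⟩

end Forward

/-! ### A 4-partition gives a matching -/

section Backward

variable {q : ℕ} {T : List (Fin q × Fin q × Fin q)} {g : Fin T.length × Fin 4 → Fin T.length}

/-- **Four to a group** (sizes in `(B/5, B/3)`). [cite: GareyJohnson1979, §4.2.2] -/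
theorem card_fibre_eq_four (hg : ∀ j, (∑ s, if g s = j then size T s else 0) = bigB q) (j : Fin T.length) :
    (Finset.univ.filter fun s => g s = j).card = 4 := by
  classical
  set F := Finset.univ.filter fun s => g s = j
  have hsum : ∑ s ∈ F, size T s = bigB q := by rw [Finset.sum_filter]; exact hg j
  have hB : 0 < bigB q := by unfold bigB; omega
  have hne : F.Nonempty := by
    rw [Finset.nonempty_iff_ne_empty]; rintro h0; rw [h0, Finset.sum_empty] at hsum; omega
  have h1 : F.card * bigB q < 5 * bigB q := by
    calc F.card * bigB q = ∑ s ∈ F, bigB q := by rw [Finset.sum_const, smul_eq_mul]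
      _ < ∑ s ∈ F, 5 * size T s := Finset.sum_lt_sum_of_nonempty hne fun s _ => (bounds T s).1
      _ = 5 * bigB q := by rw [← Finset.mul_sum, hsum]
  have h2 : 3 * bigB q < F.card * bigB q := by
    calc 3 * bigB q = ∑ s ∈ F, 3 * size T s := by rw [← Finset.mul_sum, hsum]
      _ < ∑ s ∈ F, bigB q := Finset.sum_lt_sum_of_nonempty hne fun s _ => (bounds T s).2
      _ = F.card * bigB q := by rw [Finset.sum_const, smul_eq_mul]
  have h1' : F.card < 5 := Nat.lt_of_mul_lt_mul_right h1
  have h2' : 3 < F.card := Nat.lt_of_mul_lt_mul_right h2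
  omega

/-- **One of each kind**: in every group the residues force exactly one `u, w, x, y`. [cite: GareyJohnson1979, Thm. 4.3 (proof: "modulo r")] -/
theorem card_fibre_kind_eq_one (hg : ∀ j, (∑ s, if g s = j then size T s else 0) = bigB q) (j : Fin T.length) (κ : Fin 4) :
    (Finset.univ.filter fun s : Fin T.length × Fin 4 => g s = j ∧ s.2 = κ).card = 1 := by
  classical
  set F := Finset.univ.filter fun s => g s = j with hF
  have h4 : F.card = 4 := card_fibre_eq_four hg j
  have hsum : ∑ s ∈ F, size T s = bigB q := by rw [Finset.sum_filter]; exact hg j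
  have hr : 32 ≤ rr q := rr_ge T[j]
  -- counts per kind
  have hfib : ∀ (f : Fin T.length × Fin 4 → ℕ), ∑ s ∈ F, f s = ∑ κ' : Fin 4, ∑ s ∈ F.filter (fun s => s.2 = κ'), f s :=
    fun f => (Finset.sum_fiberwise_of_maps_to (g := fun s => s.2) (fun s _ => Finset.mem_univ _) f).symm
  have hconst : ∀ (κ' : Fin 4) (f : Fin 4 → ℕ), ∑ s ∈ F.filter (fun s => s.2 = κ'), f s.2 = (F.filter fun s => s.2 = κ').card * f κ' := by
    intro κ' f
    rw [Finset.sum_congr rfl (g := fun _ => f κ') fun s hs => by rw [(Finset.mem_filter.1 hs).2], Finset.sum_const, smul_eq_mul]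
  have hcount : (F.filter fun s => s.2 = 0).card + (F.filter fun s => s.2 = 1).card + (F.filter fun s => s.2 = 2).card +
      (F.filter fun s => s.2 = 3).card = 4 := by
    have := hfib fun _ => 1
    rw [Fin.sum_univ_four, hconst 0 (fun _ => 1), hconst 1 (fun _ => 1), hconst 2 (fun _ => 1), hconst 3 (fun _ => 1)] at this
    simp only [Finset.sum_const, smul_eq_mul, mul_one, h4] at this
    omega
  have hres : 8 * (F.filter fun s => s.2 = 0).card + (F.filter fun s => s.2 = 1).card + 2 * (F.filter fun s => s.2 = 2).card +
      4 * (F.filter fun s => s.2 = 3).card = 15 := by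
    -- `Σ size = r Σ quo + Σ resid` and `Σ resid ≡ 15 (mod r)`, `Σ resid ≤ 32 ≤ r`
    have e1 : ∑ s ∈ F, size T s = rr q * ∑ s ∈ F, quo T s + ∑ s ∈ F, resid s.2 := by
      rw [Finset.mul_sum, ← Finset.sum_add_distrib]
      exact Finset.sum_congr rfl fun s _ => size_eq T s
    have e2 : ∑ s ∈ F, resid s.2 = 8 * (F.filter fun s => s.2 = 0).card + (F.filter fun s => s.2 = 1).card +
        2 * (F.filter fun s => s.2 = 2).card + 4 * (F.filter fun s => s.2 = 3).card := by
      rw [hfib (fun s => resid s.2), Fin.sum_univ_four, hconst 0 resid, hconst 1 resid, hconst 2 resid, hconst 3 resid]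
      have r0 : resid 0 = 8 := rfl
      have r1 : resid 1 = 1 := rfl
      have r2 : resid 2 = 2 := rfl
      have r3 : resid 3 = 4 := rfl
      rw [r0, r1, r2, r3]
      ring
    rw [hsum, e2] at e1
    set R := 8 * (F.filter fun s => s.2 = 0).card + (F.filter fun s => s.2 = 1).card +
        2 * (F.filter fun s => s.2 = 2).card + 4 * (F.filter fun s => s.2 = 3).card with hR
    have hle : R ≤ 32 := by omega
    have hmod := congrArg (· % rr q) e1
    simp only [bigB] at hmod
    rw [show (40 * rr q ^ 4 + 15) = rr q * (40 * rr q ^ 3) + 15 by ring, Nat.mul_add_mod, Nat.mul_add_mod,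
      Nat.mod_eq_of_lt (by omega : 15 < rr q)] at hmod
    by_contra hne
    rcases Nat.lt_or_ge R (rr q) with hlt | hge
    · rw [Nat.mod_eq_of_lt hlt] at hmod; exact hne hmod.symm
    · have : R = rr q := by omega
      rw [this, Nat.mod_self] at hmod; omega
  obtain ⟨h0, h1, h2, h3⟩ := counts_eq_one _ _ _ _ hcount hres
  have key : (F.filter fun s => s.2 = κ).card = 1 := by
    obtain rfl | rfl | rfl | rfl : κ = 0 ∨ κ = 1 ∨ κ = 2 ∨ κ = 3 := by omega
    exacts [h0, h1, h2, h3]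
  rw [← key, hF, Finset.filter_filter]

variable (hg : ∀ j, (∑ s, if g s = j then size T s else 0) = bigB q)
include hg

/-- The slot of kind `κ` in group `j`. [cite: GareyJohnson1979, Thm. 4.3] -/
noncomputable def slotOf (j : Fin T.length) (κ : Fin 4) : Fin T.length :=
  (Classical.choose (Finset.card_eq_one.1 (card_fibre_kind_eq_one hg j κ))).1

/-- **Membership in a group is being its slot of that kind.** [cite: GareyJohnson1979, Thm. 4.3] -/
theorem apply_eq_iff (j : Fin T.length) (κ : Fin 4) (l : Fin T.length) : g (l, κ) = j ↔ l = slotOf hg j κ := by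
  classical
  have hspec := Classical.choose_spec (Finset.card_eq_one.1 (card_fibre_kind_eq_one hg j κ))
  set a := Classical.choose (Finset.card_eq_one.1 (card_fibre_kind_eq_one hg j κ)) with ha
  have hmem : ∀ s : Fin T.length × Fin 4, (g s = j ∧ s.2 = κ) ↔ s = a := by
    intro s
    have := Finset.ext_iff.1 hspec s
    simpa using this
  have ha2 : a.2 = κ := ((hmem a).2 rfl).2
  constructor
  · intro h
    have := (hmem (l, κ)).1 ⟨h, rfl⟩
    show l = a.1
    rw [← this]
  · intro h
    have : (l, κ) = a := by rw [h]; exact Prod.ext rfl ha2.symm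
    exact ((hmem (l, κ)).2 this).1

/-- The slot of kind `κ` is in group `j`. [folklore] -/
theorem apply_slotOf (j : Fin T.length) (κ : Fin 4) : g (slotOf hg j κ, κ) = j := (apply_eq_iff hg j κ _).2 rfl

/-- The group sum, slot by slot. [folklore] -/
theorem sum_slots (j : Fin T.length) :
    size T (slotOf hg j 0, 0) + size T (slotOf hg j 1, 1) + size T (slotOf hg j 2, 2) + size T (slotOf hg j 3, 3) = bigB q := by
  classical
  have h := hg j
  rw [Fintype.sum_prod_type, Finset.sum_comm] at h
  have hκ : ∀ κ : Fin 4, (∑ l : Fin T.length, if g (l, κ) = j then size T (l, κ) else 0) = size T (slotOf hg j κ, κ) := by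
    intro κ
    simp only [apply_eq_iff hg j κ]
    rw [Finset.sum_ite_eq']
    simp
  simp only [hκ, Fin.sum_univ_four] at h
  exact h

/-- **The structure of a group**: the occurrence slots carry the coordinates of the `u`-slot's
triple, and they are all actual or all dummy. [cite: GareyJohnson1979, Thm. 4.3 (proof: "modulo r², r³, r⁴, r⁵")] -/
theorem group_structure (j : Fin T.length) :
    (∀ c : Fin 3, coord T[(slotOf hg j c.succ).val] c = coord T[(slotOf hg j 0).val] c) ∧
      ((∀ c : Fin 3, First T (slotOf hg j c.succ) c) ∨ (∀ c : Fin 3, ¬First T (slotOf hg j c.succ) c)) := by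
  have h := sum_slots hg j
  set l₀ := slotOf hg j 0
  set l₁ := slotOf hg j 1
  set l₂ := slotOf hg j 2
  set l₃ := slotOf hg j 3
  have hr : 32 ≤ rr q := rr_ge T[j]
  have hq : ∀ (t : Fin q × Fin q × Fin q) (c : Fin 3), coord t c < q := coord_lt
  have hqr : q ≤ rr q := by unfold rr; omega
  -- the equation in `ℤ`
  have hL := low_sum_lt T[l₀.val]
  have hle : low T[l₀.val] 0 + low T[l₀.val] 1 + low T[l₀.val] 2 ≤ 10 * rr q ^ 4 := by omega
  unfold size at h
  simp only [Fin.isValue, if_true, one_ne_zero, if_false, Fin.reduceEq, Fin.getElem_fin] at h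
  have k1 : kind 1 = 0 := rfl
  have k2 : kind 2 = 1 := rfl
  have k3 : kind 3 = 2 := rfl
  have r1 : resid 1 = 1 := rfl
  have r2 : resid 2 = 2 := rfl
  have r3 : resid 3 = 4 := rfl
  simp only [k1, k2, k3, r1, r2, r3, bigB] at h
  have hz : ((coef T l₁ 0 + coef T l₂ 1 + coef T l₃ 2 : ℕ) - 30 : ℤ) * (rr q : ℤ) ^ 3 +
      ((coord T[l₃.val] 2 : ℤ) - coord T[l₀.val] 2) * (rr q : ℤ) ^ 2 +
      ((coord T[l₂.val] 1 : ℤ) - coord T[l₀.val] 1) * (rr q : ℤ) +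
      ((coord T[l₁.val] 0 : ℤ) - coord T[l₀.val] 0) = 0 := by
    have h' := congrArg (Nat.cast : ℕ → ℤ) h
    push_cast [Nat.cast_sub hle] at h'
    simp only [low, Fin.val_zero, Fin.val_one, Fin.val_two] at h'
    push_cast at h'
    have hr0 : (rr q : ℤ) ≠ 0 := by positivity
    have : (rr q : ℤ) * (((coef T l₁ 0 + coef T l₂ 1 + coef T l₃ 2 : ℕ) - 30 : ℤ) * (rr q : ℤ) ^ 3 +
        ((coord T[l₃.val] 2 : ℤ) - coord T[l₀.val] 2) * (rr q : ℤ) ^ 2 +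
        ((coord T[l₂.val] 1 : ℤ) - coord T[l₀.val] 1) * (rr q : ℤ) +
        ((coord T[l₁.val] 0 : ℤ) - coord T[l₀.val] 0)) = 0 := by
      push_cast
      linear_combination h'
    rcases mul_eq_zero.1 this with h0 | h0
    · exact absurd h0 hr0
    · exact h0
  have habs : ∀ (a b : ℕ), a < q → b < q → |(a : ℤ) - b| < rr q := by
    intro a b ha hb
    rw [abs_lt]; constructor <;> omega
  obtain ⟨e1, e2, e3, e4⟩ := digits_eq_zero (r := (rr q : ℤ)) (by positivity)
    (habs _ _ (hq _ _) (hq _ _)) (habs _ _ (hq _ _) (hq _ _)) (habs _ _ (hq _ _) (hq _ _)) hz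
  refine ⟨fun c => ?_, ?_⟩
  · obtain rfl | rfl | rfl : c = 0 ∨ c = 1 ∨ c = 2 := by omega
    · exact_mod_cast (sub_eq_zero.1 e1)
    · exact_mod_cast (sub_eq_zero.1 e2)
    · exact_mod_cast (sub_eq_zero.1 e3)
  · have hsum : coef T l₁ 0 + coef T l₂ 1 + coef T l₃ 2 = 30 := by
      have c1 := coef_cases T l₁ 0
      have c2 := coef_cases T l₂ 1
      have c3 := coef_cases T l₃ 2
      omega
    have hc : ∀ (l : Fin T.length) (c : Fin 3), coef T l c = 10 ↔ First T l c := by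
      intro l c
      unfold coef
      split_ifs with h1 h2 <;> simp [h1]
    rcases coeffs_cases (c₁ := coef T l₁ 0) (c₂ := coef T l₂ 1) (c₃ := coef T l₃ 2)
        (by have := coef_cases T l₁ 0; omega) (by have := coef_cases T l₂ 1; omega)
        (by have := coef_cases T l₃ 2; omega) hsum with ⟨a1, a2, a3⟩ | ⟨a1, a2, a3⟩
    · left
      intro c
      obtain rfl | rfl | rfl : c = 0 ∨ c = 1 ∨ c = 2 := by omega
      · exact (hc _ _).1 a1
      · exact (hc _ _).1 a2
      · exact (hc _ _).1 a3
    · right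
      intro c
      obtain rfl | rfl | rfl : c = 0 ∨ c = 1 ∨ c = 2 := by omega
      · show ¬First T l₁ 0
        rw [← hc]; omega
      · show ¬First T l₂ 1
        rw [← hc]; omega
      · show ¬First T l₃ 2
        rw [← hc]; omega

omit hg in
/-- Two first occurrences of the same coordinate value coincide. [folklore] -/
theorem eq_of_first {l l' : Fin T.length} (c : Fin 3) (h : coord T[l'.val] c = coord T[l.val] c) (hf : First T l c)
    (hf' : First T l' c) : l' = l := by
  rw [first_iff] at hf hf'
  rw [← hf, ← hf', lminOf_eq_of_coord_eq T c (by simpa [Fin.getElem_fin] using h)]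

/-- Group `j` is "all actual". [cite: GareyJohnson1979, Thm. 4.3] -/
def AllAct (j : Fin T.length) : Prop := First T (slotOf hg j 1) 0

/-- In an all-actual group every occurrence slot is actual; in the others none is. [cite: GareyJohnson1979, Thm. 4.3] -/
theorem first_slotOf_iff (j : Fin T.length) (c : Fin 3) : First T (slotOf hg j c.succ) c ↔ AllAct hg j := by
  unfold AllAct
  rcases (group_structure hg j).2 with h | h
  · exact ⟨fun _ => h 0, fun _ => h c⟩
  · exact ⟨fun h' => absurd h' (h c), fun h' => absurd h' (h 0)⟩

/-- The group of the actual `w`-slot of a covered `w`-value is all actual. [folklore] -/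
theorem allAct_of_first {m : Fin T.length} (hm : First T m 0) : AllAct hg (g (m, 1)) ∧ slotOf hg (g (m, 1)) 1 = m := by
  have he : slotOf hg (g (m, 1)) 1 = m := ((apply_eq_iff hg _ 1 m).1 rfl).symm
  exact ⟨by unfold AllAct; rw [he]; exact hm, he⟩

variable (hcov : ∀ z, z < q → ∃ l : Fin T.length, coord T[l] 0 = z)
include hcov

/-- **A 4-partition yields a perfect matching**: the triples of the all-actual groups.
[cite: GareyJohnson1979, Thm. 4.3 (proof, second direction)] -/
theorem matching_of_partition : ∃ W ⊆ T.toFinset, W.card = q ∧ IsThreeDMatching W := by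
  classical
  set J : Finset (Fin T.length) := Finset.univ.filter fun j => AllAct hg j with hJ
  let tri : Fin T.length → Fin q × Fin q × Fin q := fun j => T[(slotOf hg j 0).val]
  have hmemJ : ∀ j, j ∈ J ↔ AllAct hg j := fun j => by simp [hJ]
  -- distinct all-actual groups have coordinatewise distinct triples
  have hdist : ∀ j ∈ J, ∀ j' ∈ J, ∀ c : Fin 3, coord (tri j) c = coord (tri j') c → j = j' := by
    intro j hj j' hj' c h
    rw [hmemJ] at hj hj'
    have h1 := (group_structure hg j).1 c
    have h2 := (group_structure hg j').1 c
    have he : slotOf hg j' c.succ = slotOf hg j c.succ :=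
      eq_of_first c (by rw [h1, h2]; exact h.symm) ((first_slotOf_iff hg j c).2 hj) ((first_slotOf_iff hg j' c).2 hj')
    have := apply_slotOf hg j' c.succ
    rw [he, apply_slotOf hg j c.succ] at this
    exact this
  refine ⟨J.image tri, ?_, ?_, ?_⟩
  · intro t ht
    obtain ⟨j, -, rfl⟩ := Finset.mem_image.1 ht
    exact List.mem_toFinset.2 (List.getElem_mem _)
  · have hinj : Set.InjOn tri J := fun j hj j' hj' h => hdist j hj j' hj' 0 (by rw [h])
    rw [Finset.card_image_of_injOn hinj]
    apply le_antisymm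
    · -- `j ↦` the `w`-value of its triple is injective on `J`
      have : J.card ≤ (Finset.range q).card := by
        refine Finset.card_le_card_of_injOn (fun j => coord (tri j) 0) (fun j _ => ?_) fun j hj j' hj' h => ?_
        · exact Finset.mem_coe.2 (Finset.mem_range.2 (coord_lt _ _))
        · exact hdist j (Finset.mem_coe.1 hj) j' (Finset.mem_coe.1 hj') 0 h
      simpa using this
    · -- every `w`-value is covered; its actual slot lies in an all-actual group
      rcases Nat.eq_zero_or_pos q with hq0 | hq0
      · omega
      obtain ⟨l₀, -⟩ := hcov 0 hq0
      let φ : ℕ → Fin T.length := fun z => if hz : z < q then g (lminOf T (Classical.choose (hcov z hz)) 0, 1) else l₀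
      have hφ : ∀ z (hz : z < q), φ z ∈ J ∧ coord T[(slotOf hg (φ z) 1).val] 0 = z := by
        intro z hz
        simp only [φ, dif_pos hz]
        obtain ⟨h1, h2⟩ := allAct_of_first hg (first_lminOf T (Classical.choose (hcov z hz)) 0)
        refine ⟨(hmemJ _).2 h1, ?_⟩
        simp only [h2]
        have e1 := coord_lminOf T (Classical.choose (hcov z hz)) 0
        have e2 := Classical.choose_spec (hcov z hz)
        simp only [Fin.getElem_fin] at e1 e2
        rw [e1, e2]
      have : (Finset.range q).card ≤ J.card := by
        refine Finset.card_le_card_of_injOn φ (fun z hz => Finset.mem_coe.2 (hφ z (Finset.mem_range.1 (Finset.mem_coe.1 hz))).1)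
          fun z hz z' hz' h => ?_
        have e1 := (hφ z (Finset.mem_range.1 (Finset.mem_coe.1 hz))).2
        have e2 := (hφ z' (Finset.mem_range.1 (Finset.mem_coe.1 hz'))).2
        have e3 : coord T[(slotOf hg (φ z) 1).val] 0 = coord T[(slotOf hg (φ z') 1).val] 0 := by simp only [h]
        exact e1.symm.trans (e3.trans e2)
      simpa using this
  · intro s hs t ht hne
    obtain ⟨j, hj, rfl⟩ := Finset.mem_image.1 hs
    obtain ⟨j', hj', rfl⟩ := Finset.mem_image.1 ht
    have hjj : j ≠ j' := fun e => hne (by rw [e])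
    refine ⟨fun e => hjj (hdist j hj j' hj' 0 ?_), fun e => hjj (hdist j hj j' hj' 1 ?_), fun e => hjj (hdist j hj j' hj' 2 ?_)⟩
    · simp [coord, e]
    · simp [coord, e]
    · simp [coord, e]

end Backward

/-! ### The list of sizes and the equivalence -/

section ListForm

variable {q : ℕ} (T : List (Fin q × Fin q × Fin q))

/-- Slots `(l, κ) ↦ 4l + κ`. [folklore] -/
def slotEquiv : Fin T.length × Fin 4 ≃ Fin (4 * T.length) :=
  finProdFinEquiv.trans (finCongr (Nat.mul_comm _ _))

/-- **The list of the `4|T|` sizes**, in the order `u_0, w(0), x(0), y(0), u_1, …`. [cite: GareyJohnson1979, Thm. 4.3] -/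
def sizes : List ℕ := List.ofFn fun a : Fin (4 * T.length) => size T ((slotEquiv T).symm a)

/-- `|sizes T| = 4|T|`. [folklore] -/
@[simp] theorem length_sizes : (sizes T).length = 4 * T.length := List.length_ofFn

/-- Entries of `sizes`. [folklore] -/
theorem sizes_getElem (a : Fin (4 * T.length)) : (sizes T)[a.val]'(by simp) = size T ((slotEquiv T).symm a) := by
  simp [sizes]

/-- The position of slot `(l, κ)` is `4l + κ`. [folklore] -/
theorem slotEquiv_val (l : Fin T.length) (κ : Fin 4) : ((slotEquiv T) (l, κ)).val = 4 * l.val + κ.val := by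
  simp [slotEquiv, finProdFinEquiv, Nat.mul_comm]
  omega

/-- **Every size lies strictly between `B/5` and `B/3`.** [cite: GareyJohnson1979, Thm. 4.3] -/
theorem bounds_sizes : ∀ x ∈ sizes T, bigB q < 5 * x ∧ 3 * x < bigB q := by
  intro x hx
  rw [sizes, List.mem_ofFn] at hx
  obtain ⟨a, rfl⟩ := hx
  exact bounds T _

/-- Assignments of list positions and of slots correspond. [folklore] -/
theorem exists_assign_iff :
    (∃ g : Fin (sizes T).length → Fin T.length, ∀ j, (∑ a, if g a = j then (sizes T)[a.val] else 0) = bigB q) ↔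
      ∃ g : Fin T.length × Fin 4 → Fin T.length, ∀ j, (∑ s, if g s = j then size T s else 0) = bigB q := by
  -- transport along `slotEquiv` followed by the cast of the length
  let e : Fin T.length × Fin 4 ≃ Fin (sizes T).length := (slotEquiv T).trans (finCongr (length_sizes T).symm)
  have he : ∀ s, (sizes T)[(e s).val] = size T s := by
    intro s
    have : (e s).val = ((slotEquiv T) s).val := by simp [e]
    simp only [this, sizes_getElem, Equiv.symm_apply_apply]
  constructor
  · rintro ⟨g, hg⟩
    refine ⟨g ∘ e, fun j => ?_⟩
    rw [← hg j, ← Equiv.sum_comp e]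
    simp only [Function.comp_apply, he]
    exact Finset.sum_congr rfl fun x _ => by congr 1
  · rintro ⟨g, hg⟩
    refine ⟨g ∘ e.symm, fun j => ?_⟩
    rw [← hg j, ← Equiv.sum_comp e]
    simp only [Function.comp_apply, Equiv.symm_apply_apply, he]

/-- **Theorem 4.3 (the equivalence)**: for a list of distinct triples covering every `w`-value,
a perfect matching exists iff the 4-PARTITION instance `(sizes T, B)` is solvable.
[cite: GareyJohnson1979, Thm. 4.3] -/
theorem matching_iff (hT : T.Nodup) (hcov : ∀ z, z < q → ∃ l : Fin T.length, coord T[l] 0 = z) :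
    (∃ W ⊆ T.toFinset, W.card = q ∧ IsThreeDMatching W) ↔
      ∃ g : Fin (sizes T).length → Fin T.length, ∀ j, (∑ a, if g a = j then (sizes T)[a.val] else 0) = bigB q := by
  rw [exists_assign_iff]
  constructor
  · rintro ⟨W, hW, hcard, hm⟩
    exact partition_of_matching hT hW hcard hm
  · rintro ⟨g, hg⟩
    exact matching_of_partition hg hcov

end ListForm


end GJ4P

end Literature.Computability.Complexity
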